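import Mathlib
import HarnessLib
import Summits.QuantumAdvantage.QuantumAdvantage.Theorems.DigitDialD

set_option linter.dupNamespace false
set_option autoImplicit false

/-!
# DigitDial (H) — the junta subgroup `Γ_J ≤ (ℤ/M)^K` of `K` linear forms: partial orthogonality, the annihilator, and a
# FIELD-FREE regularisation (cell decomp-qadv, lens 4, g20 rev 4)

Prop-definition-free tree twin of §9a of the lens-4 g20 node `DigitDial` (the tree's `LinFormsOrthogonality` / `LinFormsMain`
machinery, typed there for `[Fact p.Prime]`, re-proved for a general modulus `[NeZero M]`, plus a regularisation that needs no field).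
* `gammaJ`, `dotM`, `sum_gammaJ_char` (`Σ_{γ∈Γ_J} e_M⟨γ,x⟩ = |Γ_J|·[x ⊥ Γ_J]`), `ite_eq_zero_split`, `perp`, `card_gammaJ_mul_card_perp`
  (`|Γ_J|·|Γ_J^⊥| = M^K`), `juntaVal`, `dotM_linVal_sub_juntaVal`, `sum_perp_cells_eq` (re-indexing of the junta cells);
* `bsupp`, `two_mul_card_gammaJ_le` (a `γ₀ ∈ Γ_{J'} ∖ Γ_J` doubles the subgroup), `exists_reg_junta`: a junta set `J` with
  `|J| ≤ (log₂(M^K)+1)·s` off which every `γ ∉ Γ_J` has `≥ s` non-zero coefficients `Σ_j γ_j λ_j` (greedy subgroup chain; replaces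
  `LinFormsJuntaSet.exists_regular_span`, Gaussian elimination over `𝔽_p`).
0 sorry; axioms standard; no `instance`, no `notation`, no `native_decide`; no `def … : Prop`.
-/

noncomputable section

namespace Summit.QuantumAdvantage.QuantumAdvantage.Theorems.DigitDial

open Finset Summit.QuantumAdvantage.AdviceFreeQNC0 Literature.Computability.MetaComplexity
open TwistedTransfer ConstBells

/-! ## §9  EVERY strategy of polylog LINEAR RANK mod `M` loses — the `ℤ/M` form of R11′ with a FIELD-FREE regularisation (node `DigitDial` §9, rev 4)

`y_g(u) = tab_g(λ(u))` for ANY `K` linear forms mod ANY `M` coprime to `3`, NO spreadness hypothesis: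
`#WIN ≤ (3/4 + 3·M^K·cos(π/3M)^s)·2ⁿ` as soon as `(log₂(M^K) + 1)·s + 4 ≤ n` (`linStrat_card_win_le_rank`).  The junta subgroup
`Γ_J = {γ : β(γ) = Σ γ_j λ_j supported in J}` and its annihilator split every cell indicator conditioning-free — the tree's
PROVER3-MEMO-gen9 §4 / `LinForms.card_win_le`, typed there for PRIME `p` with the junta set from the FIELD regularisation
`exists_regular_span` — here `J` comes from a greedy SUBGROUP-CHAIN regularisation valid over `ℤ/M` (`exists_reg_junta`: while
some `γ ∉ Γ_J` has `< s` non-zero coefficients, add them to `J`; `Γ_J` at least doubles (`two_mul_card_gammaJ_le`), so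
`≤ log₂(M^K)` rounds and `|J| ≤ (log₂(M^K)+1)·s`); the main term re-indexes into the `J`-junta strategies
`z_δ(u) = tab(λ_J(u) + δ)`, `δ ∈ Γ_J^⊥` (`hiddenCoinsFour` WITH the junta, `|Γ_J|·|Γ_J^⊥| = M^K`), the error terms are §1 twisted
sums of constant strategies.  Consequence (§6): `TLin` — `T` restricted to strategies reading `K ≤ (log₂ n)^C` forms mod
`M ≤ (log₂ n)^C`, `3 ∤ M`, through ARBITRARY tables — PROVED, field-free; weight residues (`W`), symmetric / Young-symmetric /
junta ⊕ Young (`W′, W″, W⁗`) and spread forms (`W‴`) are all of polylog linear rank. -/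

section LinRankH

variable {n K : ℕ} {M : ℕ} [NeZero M]

/-- The junta subgroup `Γ_J = {γ : β(γ) supported in J}` (as a finset; general modulus). -/
def gammaJ (lam : Fin K → Fin n → ZMod M) (J : Finset (Fin n)) : Finset (Fin K → ZMod M) :=
  univ.filter fun γ => ∀ i : Fin n, i ∉ J → (∑ j, γ j * lam j i) = 0

/-- Membership in `Γ_J`. [bookkeeping] -/
theorem mem_gammaJ {lam : Fin K → Fin n → ZMod M} {J : Finset (Fin n)} {γ : Fin K → ZMod M} :
    γ ∈ gammaJ lam J ↔ ∀ i : Fin n, i ∉ J → (∑ j, γ j * lam j i) = 0 := by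
  unfold gammaJ; simp

/-- `0 ∈ Γ_J`. [bookkeeping] -/
theorem zero_mem_gammaJ (lam : Fin K → Fin n → ZMod M) (J : Finset (Fin n)) : (0 : Fin K → ZMod M) ∈ gammaJ lam J := by
  rw [mem_gammaJ]; intro i _; simp

/-- `Γ_J` is closed under addition. [bookkeeping] -/
theorem add_mem_gammaJ {lam : Fin K → Fin n → ZMod M} {J : Finset (Fin n)} {γ γ' : Fin K → ZMod M}
    (h : γ ∈ gammaJ lam J) (h' : γ' ∈ gammaJ lam J) : γ + γ' ∈ gammaJ lam J := by
  rw [mem_gammaJ] at h h' ⊢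
  intro i hi
  have e : (∑ j, (γ + γ') j * lam j i) = (∑ j, γ j * lam j i) + ∑ j, γ' j * lam j i := by
    rw [← Finset.sum_add_distrib]; exact Finset.sum_congr rfl fun j _ => by simp [add_mul]
  rw [e, h i hi, h' i hi, add_zero]

/-- `Γ_J` is closed under negation. [bookkeeping] -/
theorem neg_mem_gammaJ {lam : Fin K → Fin n → ZMod M} {J : Finset (Fin n)} {γ : Fin K → ZMod M}
    (h : γ ∈ gammaJ lam J) : -γ ∈ gammaJ lam J := by
  rw [mem_gammaJ] at h ⊢
  intro i hi
  have e : (∑ j, (-γ) j * lam j i) = -(∑ j, γ j * lam j i) := by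
    rw [← Finset.sum_neg_distrib]; exact Finset.sum_congr rfl fun j _ => by simp [neg_mul]
  rw [e, h i hi, neg_zero]

/-- `Γ_J` is closed under subtraction. [bookkeeping] -/
theorem sub_mem_gammaJ {lam : Fin K → Fin n → ZMod M} {J : Finset (Fin n)} {γ γ' : Fin K → ZMod M}
    (h : γ ∈ gammaJ lam J) (h' : γ' ∈ gammaJ lam J) : γ - γ' ∈ gammaJ lam J := by
  rw [sub_eq_add_neg]; exact add_mem_gammaJ h (neg_mem_gammaJ h')

/-- `Γ_J` is monotone in `J`. [bookkeeping] -/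
theorem gammaJ_mono (lam : Fin K → Fin n → ZMod M) {J J' : Finset (Fin n)} (hJ : J ⊆ J') :
    gammaJ lam J ⊆ gammaJ lam J' := by
  intro γ hγ
  rw [mem_gammaJ] at hγ ⊢
  exact fun i hi => hγ i (fun h => hi (hJ h))

/-- The pairing `⟨γ, x⟩ = Σ_j γ_j x_j` on `(ℤ/M)^K`. -/
def dotM (γ x : Fin K → ZMod M) : ZMod M := ∑ j, γ j * x j

omit [NeZero M] in
/-- [bookkeeping] -/
theorem dotM_add_left (γ γ' x : Fin K → ZMod M) : dotM (γ + γ') x = dotM γ x + dotM γ' x := by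
  unfold dotM; rw [← Finset.sum_add_distrib]; exact Finset.sum_congr rfl fun j _ => by simp [add_mul]

omit [NeZero M] in
/-- [bookkeeping] -/
theorem dotM_add_right (γ x x' : Fin K → ZMod M) : dotM γ (x + x') = dotM γ x + dotM γ x' := by
  unfold dotM; rw [← Finset.sum_add_distrib]; exact Finset.sum_congr rfl fun j _ => by simp [mul_add]

omit [NeZero M] in
/-- [bookkeeping] -/
theorem dotM_comm (γ x : Fin K → ZMod M) : dotM γ x = dotM x γ := by
  unfold dotM; exact Finset.sum_congr rfl fun j _ => mul_comm _ _

omit [NeZero M] in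
/-- [bookkeeping] -/
theorem dotM_neg (γ y : Fin K → ZMod M) : dotM γ (-y) = -dotM γ y := by
  unfold dotM; rw [← Finset.sum_neg_distrib]; exact Finset.sum_congr rfl fun j _ => by simp [mul_neg]

/-- **Partial orthogonality over the subgroup `Γ_J`** (general modulus): `Σ_{γ ∈ Γ_J} e_M(⟨γ,x⟩) = |Γ_J|·[x ⊥ Γ_J]`. -/
theorem sum_gammaJ_char (lam : Fin K → Fin n → ZMod M) (J : Finset (Fin n)) (x : Fin K → ZMod M) :
    (∑ γ ∈ gammaJ lam J, (ZMod.stdAddChar (dotM γ x) : ℂ)) =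
      if (∀ γ ∈ gammaJ lam J, dotM γ x = 0) then ((gammaJ lam J).card : ℂ) else 0 := by
  classical
  split_ifs with h
  · rw [Finset.sum_congr rfl (fun γ hγ => by rw [h γ hγ, AddChar.map_zero_eq_one]), Finset.sum_const, nsmul_eq_mul,
      mul_one]
  · push Not at h
    obtain ⟨γ₀, hγ₀, ht⟩ := h
    set S := ∑ γ ∈ gammaJ lam J, (ZMod.stdAddChar (dotM γ x) : ℂ) with hS
    have hperm : (ZMod.stdAddChar (dotM γ₀ x) : ℂ) * S = S := by
      rw [hS, Finset.mul_sum]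
      have hf : ∀ γ ∈ gammaJ lam J, (ZMod.stdAddChar (dotM γ₀ x) : ℂ) * ZMod.stdAddChar (dotM γ x) =
          ZMod.stdAddChar (dotM (γ + γ₀) x) := fun γ _ => by
        rw [dotM_add_left, AddChar.map_add_eq_mul, mul_comm]
      rw [Finset.sum_congr rfl hf]
      refine Finset.sum_nbij (fun γ => γ + γ₀) (fun γ hγ => add_mem_gammaJ hγ hγ₀) (fun γ _ γ' _ h => by simpa using h)
        (fun γ hγ => ⟨γ - γ₀, ?_, by simp⟩) (fun γ _ => rfl)
      exact Finset.mem_coe.2 (sub_mem_gammaJ (Finset.mem_coe.1 hγ) hγ₀)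
    have hne : (ZMod.stdAddChar (dotM γ₀ x) : ℂ) ≠ 1 := by
      rw [Ne, Literature.Analysis.Fourier.stdAddChar_eq_one_iff]; exact ht
    have h0 : ((ZMod.stdAddChar (dotM γ₀ x) : ℂ) - 1) * S = 0 := by rw [sub_mul, one_mul, hperm, sub_self]
    rcases mul_eq_zero.1 h0 with h1 | h2
    · exact absurd (sub_eq_zero.1 h1) hne
    · exact h2

/-- **Splitting the point indicator along `Γ_J`** (general modulus):
`[x = 0] = M^{-K}|Γ_J|·[x ⊥ Γ_J] + M^{-K} Σ_{γ ∉ Γ_J} e_M(⟨γ,x⟩)`. -/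
theorem ite_eq_zero_split (lam : Fin K → Fin n → ZMod M) (J : Finset (Fin n)) (x : Fin K → ZMod M) :
    (if x = 0 then (1 : ℂ) else 0) =
      ((M : ℂ) ^ K)⁻¹ * ((gammaJ lam J).card : ℂ) * (if (∀ γ ∈ gammaJ lam J, dotM γ x = 0) then (1 : ℂ) else 0) +
      ((M : ℂ) ^ K)⁻¹ * ∑ γ ∈ univ.filter (fun γ => γ ∉ gammaJ lam J), (ZMod.stdAddChar (dotM γ x) : ℂ) := by
  classical
  have hfull := TwoModuli.sum_stdAddChar_dot_eq_ite (p := M) x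
  have hsplit : (∑ γ : Fin K → ZMod M, (ZMod.stdAddChar (∑ j, γ j * x j) : ℂ)) =
      (∑ γ ∈ gammaJ lam J, (ZMod.stdAddChar (dotM γ x) : ℂ)) +
      ∑ γ ∈ univ.filter (fun γ => γ ∉ gammaJ lam J), (ZMod.stdAddChar (dotM γ x) : ℂ) := by
    rw [← Finset.sum_filter_add_sum_filter_not univ (fun γ => γ ∈ gammaJ lam J), Finset.filter_univ_mem]
    rfl
  rw [hsplit, sum_gammaJ_char] at hfull
  have hpK : ((M : ℂ) ^ K) ≠ 0 := pow_ne_zero _ (by exact_mod_cast NeZero.ne M)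
  have key : (if x = 0 then (1 : ℂ) else 0) = ((M : ℂ) ^ K)⁻¹ * (if x = 0 then ((M : ℂ) ^ K) else 0) := by
    split_ifs
    · field_simp
    · simp
  rw [key, ← hfull]
  split_ifs <;> ring

/-- The annihilator `Γ_J^⊥`. -/
def perp (lam : Fin K → Fin n → ZMod M) (J : Finset (Fin n)) : Finset (Fin K → ZMod M) :=
  univ.filter fun x => ∀ γ ∈ gammaJ lam J, dotM γ x = 0

/-- Membership in `Γ_J^⊥`. [bookkeeping] -/
theorem mem_perp {lam : Fin K → Fin n → ZMod M} {J : Finset (Fin n)} {x : Fin K → ZMod M} :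
    x ∈ perp lam J ↔ ∀ γ ∈ gammaJ lam J, dotM γ x = 0 := by
  unfold perp; simp

/-- **`|Γ_J|·|Γ_J^⊥| = M^K`** (double counting with the two orthogonality relations). -/
theorem card_gammaJ_mul_card_perp (lam : Fin K → Fin n → ZMod M) (J : Finset (Fin n)) :
    ((gammaJ lam J).card : ℂ) * ((perp lam J).card : ℂ) = (M : ℂ) ^ K := by
  classical
  have h1 : (∑ x : Fin K → ZMod M, ∑ γ ∈ gammaJ lam J, (ZMod.stdAddChar (dotM γ x) : ℂ)) =
      ((gammaJ lam J).card : ℂ) * ((perp lam J).card : ℂ) := by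
    simp_rw [sum_gammaJ_char]
    rw [Finset.sum_ite, Finset.sum_const_zero, add_zero, Finset.sum_const, nsmul_eq_mul, mul_comm]
    unfold perp
    rfl
  have h2 : (∑ x : Fin K → ZMod M, ∑ γ ∈ gammaJ lam J, (ZMod.stdAddChar (dotM γ x) : ℂ)) = (M : ℂ) ^ K := by
    rw [Finset.sum_comm]
    have hγ : ∀ γ ∈ gammaJ lam J, (∑ x : Fin K → ZMod M, (ZMod.stdAddChar (dotM γ x) : ℂ)) =
        if γ = 0 then (M : ℂ) ^ K else 0 := by
      intro γ _
      simp_rw [dotM_comm γ]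
      exact TwoModuli.sum_stdAddChar_dot_eq_ite (p := M) γ
    rw [Finset.sum_congr rfl hγ, Finset.sum_ite_eq' (gammaJ lam J) 0 (fun _ => (M : ℂ) ^ K), if_pos (zero_mem_gammaJ lam J)]
  rw [← h1, h2]

/-- The junta part of the residue vector: the forms restricted to `J`. -/
def juntaVal (lam : Fin K → Fin n → ZMod M) (J : Finset (Fin n)) (u : Fin n → Bool) : Fin K → ZMod M :=
  fun j => ∑ i, if (i ∈ J ∧ u i = true) then lam j i else 0

/-- The off-`J` part of the residue vector is annihilated by `Γ_J`. -/
theorem dotM_linVal_sub_juntaVal (lam : Fin K → Fin n → ZMod M) (J : Finset (Fin n)) (u : Fin n → Bool)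
    {γ : Fin K → ZMod M} (hγ : γ ∈ gammaJ lam J) : dotM γ (linVal lam u - juntaVal lam J u) = 0 := by
  rw [mem_gammaJ] at hγ
  unfold dotM linVal juntaVal
  have hterm : ∀ j, γ j * ((∑ i, if u i then lam j i else 0) - ∑ i, if (i ∈ J ∧ u i = true) then lam j i else 0) =
      ∑ i, if (i ∉ J ∧ u i = true) then γ j * lam j i else 0 := by
    intro j
    rw [← Finset.sum_sub_distrib, Finset.mul_sum]
    refine Finset.sum_congr rfl fun i _ => ?_
    by_cases hu : u i = true <;> by_cases hi : i ∈ J <;> simp [hu, hi]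
  simp_rw [Pi.sub_apply, hterm]
  rw [Finset.sum_comm]
  refine Finset.sum_eq_zero fun i _ => ?_
  by_cases h : i ∉ J ∧ u i = true
  · rw [Finset.sum_congr rfl (fun j _ => if_pos h)]
    exact hγ i h.1
  · simp [h]

/-- **Re-indexing of the junta cells**: `Σ_v [λ(u) − v ⊥ Γ_J]·W(v) = Σ_{δ ∈ Γ_J^⊥} W(λ_J(u) + δ)`. -/
theorem sum_perp_cells_eq (lam : Fin K → Fin n → ZMod M) (J : Finset (Fin n)) (u : Fin n → Bool)
    (W : (Fin K → ZMod M) → ℂ) :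
    (∑ v : Fin K → ZMod M, (if (∀ γ ∈ gammaJ lam J, dotM γ (linVal lam u - v) = 0) then W v else 0)) =
      ∑ δ ∈ perp lam J, W (juntaVal lam J u + δ) := by
  classical
  rw [← Finset.sum_filter]
  symm
  refine Finset.sum_nbij (fun δ => juntaVal lam J u + δ) (fun δ hδ => ?_) (fun δ _ δ' _ h => by simpa using h)
    (fun v hv => ?_) (fun δ _ => rfl)
  · rw [mem_perp] at hδ
    rw [mem_filter]
    refine ⟨mem_univ _, fun γ hγ => ?_⟩
    have h1 := dotM_linVal_sub_juntaVal lam J u hγ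
    have : linVal lam u - (juntaVal lam J u + δ) = (linVal lam u - juntaVal lam J u) + (-δ) := by abel
    rw [this, dotM_add_right, h1, zero_add, dotM_neg, hδ γ hγ, neg_zero]
  · rw [Finset.mem_coe, mem_filter] at hv
    refine ⟨v - juntaVal lam J u, ?_, by simp⟩
    rw [Finset.mem_coe, mem_perp]
    intro γ hγ
    have h1 := dotM_linVal_sub_juntaVal lam J u hγ
    have h2 := hv.2 γ hγ
    have : v - juntaVal lam J u = (linVal lam u - juntaVal lam J u) + (-(linVal lam u - v)) := by abel
    rw [this, dotM_add_right, h1, zero_add, dotM_neg, h2, neg_zero]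

omit [NeZero M] in
/-- The junta strategies `z_δ` read only the bits of `J`. [bookkeeping] -/
theorem juntaVal_congr (lam : Fin K → Fin n → ZMod M) (J : Finset (Fin n)) {u v : Fin n → Bool}
    (h : ∀ i ∈ J, u i = v i) : juntaVal lam J u = juntaVal lam J v := by
  funext j
  unfold juntaVal
  refine Finset.sum_congr rfl fun i _ => ?_
  by_cases hi : i ∈ J
  · rw [h i hi]
  · simp [hi]

/-- The support of the combination `β(γ) = Σ_j γ_j λ_j`. -/
def bsupp (lam : Fin K → Fin n → ZMod M) (γ : Fin K → ZMod M) : Finset (Fin n) :=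
  univ.filter fun i : Fin n => (∑ j, γ j * lam j i) ≠ 0

/-- Adding the support of `β(γ)` to `J` puts `γ` into `Γ_J`. [bookkeeping] -/
theorem mem_gammaJ_union_bsupp (lam : Fin K → Fin n → ZMod M) (J : Finset (Fin n)) (γ : Fin K → ZMod M) :
    γ ∈ gammaJ lam (J ∪ bsupp lam γ) := by
  rw [mem_gammaJ]
  intro i hi
  by_contra h
  exact hi (Finset.mem_union_right _ (by unfold bsupp; rw [mem_filter]; exact ⟨mem_univ _, h⟩))

/-- **Doubling**: if `J ⊆ J'` and some `γ₀ ∈ Γ_{J'} ∖ Γ_J`, then `2·|Γ_J| ≤ |Γ_{J'}|` (the coset `γ₀ + Γ_J`). -/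
theorem two_mul_card_gammaJ_le (lam : Fin K → Fin n → ZMod M) {J J' : Finset (Fin n)} (hJ : J ⊆ J')
    {γ₀ : Fin K → ZMod M} (h₀ : γ₀ ∈ gammaJ lam J') (h₀' : γ₀ ∉ gammaJ lam J) :
    2 * (gammaJ lam J).card ≤ (gammaJ lam J').card := by
  classical
  have hsub : gammaJ lam J ⊆ gammaJ lam J' := gammaJ_mono lam hJ
  set S := (gammaJ lam J).image (fun γ => γ + γ₀) with hS
  have hScard : S.card = (gammaJ lam J).card :=
    Finset.card_image_of_injective _ (fun a b h => by simpa using h)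
  have hSsub : S ⊆ gammaJ lam J' := by
    intro x hx
    rw [hS, Finset.mem_image] at hx
    obtain ⟨γ, hγ, rfl⟩ := hx
    exact add_mem_gammaJ (hsub hγ) h₀
  have hdisj : Disjoint (gammaJ lam J) S := by
    rw [Finset.disjoint_left]
    intro x hx hxS
    rw [hS, Finset.mem_image] at hxS
    obtain ⟨γ, hγ, hγx⟩ := hxS
    apply h₀'
    have : γ₀ = x - γ := by rw [← hγx]; abel
    rw [this]
    exact sub_mem_gammaJ hx hγ
  have hunion : (gammaJ lam J ∪ S).card = (gammaJ lam J).card + S.card := Finset.card_union_of_disjoint hdisj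
  have hle : (gammaJ lam J ∪ S).card ≤ (gammaJ lam J').card := Finset.card_le_card (Finset.union_subset hsub hSsub)
  omega

/-- Greedy regularisation, with fuel: if `|Γ_J|·2^t > M^K` then `t` rounds suffice. -/
theorem exists_reg_junta_aux (lam : Fin K → Fin n → ZMod M) (s : ℕ) :
    ∀ (t : ℕ) (J : Finset (Fin n)), M ^ K < (gammaJ lam J).card * 2 ^ t →
      ∃ J' : Finset (Fin n), J'.card ≤ J.card + t * s ∧
        ∀ γ : Fin K → ZMod M, γ ∉ gammaJ lam J' → s ≤ (bsupp lam γ).card := by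
  classical
  intro t
  induction t with
  | zero =>
    intro J hJ
    exfalso
    have : (gammaJ lam J).card ≤ M ^ K := by
      have h := Finset.card_le_univ (gammaJ lam J)
      rwa [Fintype.card_fun, ZMod.card, Fintype.card_fin] at h
    rw [pow_zero, mul_one] at hJ
    omega
  | succ t ih =>
    intro J hJ
    by_cases hall : ∀ γ : Fin K → ZMod M, γ ∉ gammaJ lam J → s ≤ (bsupp lam γ).card
    · exact ⟨J, Nat.le_add_right _ _, hall⟩
    · push Not at hall
      obtain ⟨γ₀, hγ₀, hlt⟩ := hall
      have hsub : J ⊆ J ∪ bsupp lam γ₀ := Finset.subset_union_left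
      have hmem : γ₀ ∈ gammaJ lam (J ∪ bsupp lam γ₀) := mem_gammaJ_union_bsupp lam J γ₀
      have hdouble := two_mul_card_gammaJ_le lam hsub hmem hγ₀
      have hcard₁ : (J ∪ bsupp lam γ₀).card ≤ J.card + s := by
        have := Finset.card_union_le J (bsupp lam γ₀)
        omega
      have hJ₁ : M ^ K < (gammaJ lam (J ∪ bsupp lam γ₀)).card * 2 ^ t := by
        rw [pow_succ] at hJ
        refine lt_of_lt_of_le hJ ?_
        rw [show (gammaJ lam J).card * (2 ^ t * 2) = (2 * (gammaJ lam J).card) * 2 ^ t by ring]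
        exact Nat.mul_le_mul_right _ hdouble
      obtain ⟨J', hJ'card, hJ'reg⟩ := ih (J ∪ bsupp lam γ₀) hJ₁
      refine ⟨J', ?_, hJ'reg⟩
      have : (t + 1) * s = t * s + s := by ring
      omega

/-- **Field-free regularisation**: a junta set `J` with `|J| ≤ (log₂(M^K) + 1)·s` such that every `γ ∉ Γ_J` has
`β(γ)` with at least `s` non-zero coefficients. -/
theorem exists_reg_junta (lam : Fin K → Fin n → ZMod M) (s : ℕ) :
    ∃ J : Finset (Fin n), J.card ≤ (Nat.log 2 (M ^ K) + 1) * s ∧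
      ∀ γ : Fin K → ZMod M, γ ∉ gammaJ lam J → s ≤ (bsupp lam γ).card := by
  classical
  have h0 : M ^ K < (gammaJ lam (∅ : Finset (Fin n))).card * 2 ^ (Nat.log 2 (M ^ K) + 1) := by
    have h1 : 1 ≤ (gammaJ lam (∅ : Finset (Fin n))).card := Finset.card_pos.2 ⟨0, zero_mem_gammaJ lam ∅⟩
    have h2 : M ^ K < 2 ^ (Nat.log 2 (M ^ K) + 1) := Nat.lt_pow_succ_log_self one_lt_two _
    refine lt_of_lt_of_le h2 ?_
    calc 2 ^ (Nat.log 2 (M ^ K) + 1) = 1 * 2 ^ (Nat.log 2 (M ^ K) + 1) := (one_mul _).symm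
      _ ≤ (gammaJ lam (∅ : Finset (Fin n))).card * 2 ^ (Nat.log 2 (M ^ K) + 1) := Nat.mul_le_mul_right _ h1
  obtain ⟨J, hJ, hreg⟩ := exists_reg_junta_aux lam s _ ∅ h0
  exact ⟨J, by rw [Finset.card_empty, zero_add] at hJ; exact hJ, hreg⟩

end LinRankH

end Summit.QuantumAdvantage.QuantumAdvantage.Theorems.DigitDial
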